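import Literature.NumberTheory.LFunctions.WeilGroundEnergyProofs
import HarnessLib

/-!
# Ground states of the truncated Weil quadratic form (operator-free encoding)

Sibling of `Literature/NumberTheory/LFunctions/WeilExplicit.lean` (same normalisation: additive
variable `t = log x`, test functions `IsWeilTest g`, `Q(g) = weilQuadratic g = W(g ⋆ g̃)`, ground
energy `ε(a) = weilGroundEnergy a = inf {Re Q(g) : g test, tsupport g ⊆ [-a, a], ∫ |g|² = 1}`).

## What is defined

`IsWeilGroundState a u`: `u : ℝ → ℂ` is a GROUND STATE of Weil's quadratic form on the window
`[-a, a]`, encoded WITHOUT positing an operator: `u ∈ L²` and `u` is the `L²`-limit of an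
`L²`-normalised MINIMISING SEQUENCE of test functions on the window (test functions `gₙ` with
`tsupport gₙ ⊆ [-a, a]`, `∫ |gₙ|² = 1`, `Re Q(gₙ) → ε(a)`). This is how ground states occur in
the sources:

* E. Bombieri (2000), §4 "The variational equation", Problem 2: "Minimize `T[f * f̄*]` in the
  unit sphere of the space `L²(E)` of functions `f` with compact support in `E`" (here
  `E = [e^{-a}, e^{a}]`, the window `[-a, a]` additively), with eigenvalue equation (4.2)
  `λ f − L[f] = 0`, `λ = T[f * f̄*]/‖f‖²` (Lemma 1), and Theorem 3 ("the infimum … is attained"),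
  whose proof runs: "Let `{f_ν}` be a minimizing sequence … the sequence `{f_ν}` converges to `f`
  strongly in `L²(E)` … `T[f * f̄*] ≤ lim T[f_ν * f̄_ν*]` and our assertion follows because
  `{f_ν}` is a minimizing sequence" — Bombieri's minimisers are `L²`-limits of normalised
  minimising sequences.
* A. Connes, W. van Suijlekom (2025), Theorem 6.1 (= Thm 1.2): if the minimum of the spectrum of
  the lower-bounded form on the window is a simple isolated eigenvalue `λ` with even
  eigenfunction `ξ`, "all the zeros of the entire function `ξ̂(z)` … lie on the real line"; the
  proof starts: "We normalize the eigenvector `ξ` by `‖ξ‖ = 1`. Given `ε > 0` there exists an even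
  trigonometric polynomial `η_ε` with `‖η_ε‖ = 1`, `‖ξ − η_ε‖ < ε`, `⟨η_ε | η_ε⟩_Q < λ + ε`" — the
  ground state is an `L²`-limit of normalised form-core elements with form values tending to
  the bottom.
* A. Connes (2026), §6.4: the "smallest eigenvalue `ε(λ)` of `A_λ`", `A_λ` the lower-bounded
  self-adjoint operator with `QW_λ(f, f) = ⟨A_λ f | f⟩` on test functions supported in
  `[λ⁻¹, λ]` (window `a = log λ`), and its eigenvector `θ_x`.

Why the encoding is faithful (functional analysis, for the reviewer; none of it is asserted in
Lean): `Re Q` is bounded below on the unit sphere of the window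
(`bddBelow_weilQuadratic_sphere_holds`) and closable; its closure `Q̄` is lower semicontinuous
in `L²`, so an `L²`-limit `u` of a normalised minimising sequence has `‖u‖₂ = 1` and
`Q̄(u) ≤ liminf Re Q(gₙ) = ε(a)`, i.e. `u` is a normalised bottom eigenvector of the associated
(Friedrichs) self-adjoint operator; conversely, test functions on the window being a form core,
every normalised bottom eigenvector is such a limit (first display of the proof of C–vS Thm 6.1
above). The predicate asserts neither existence (Bombieri's Thm 3) nor uniqueness.

## API (all proved)

`IsWeilGroundState.integral_norm_sq` (`∫ |u|² = 1`), `.eLpNorm_eq_one`, `.pos` (`0 < a`),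
`.ae_eq_zero_of_notMem` (`u = 0` a.e. off `[-a, a]`), `.ae_eq_indicator`, `.integrableOn`,
`.integrable`, `.integrable_mul_continuous`, `.integrable_mul_cexp` (`u(t) e^{ct} ∈ L¹`),
`.hasDerivAt_weilMellin`, `.differentiable_weilMellin` (`û = weilMellin u` is entire), the
invariances `.const_mul` / `.smul` (phases `|c| = 1`) and `.congr_ae` (null-set modification),
and non-vacuity of the hypotheses: `exists_isWeilTest_sphere`, `exists_weilMinimizingSeq`
(normalised minimising sequences exist for every `a > 0`, so `ε(a)` is a genuine infimum). NOT
proved: convergence of some minimising sequence (Bombieri's Thm 3), i.e. `∃ u, IsWeilGroundState a u`.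

## References

* E. Bombieri, *Remarks on Weil's quadratic functional in the theory of prime numbers I*, Rend.
  Mat. Acc. Lincei (9) 11 (2000), 183–233, §4: Problem 2, Lemma 1 (4.2), Theorem 3.
* A. Connes, W. D. van Suijlekom, *Quadratic Forms, Real Zeros and Echoes of the Spectral Action*,
  Comm. Math. Phys. 406 (2025), arXiv:2511.23257, Theorems 1.2 and 6.1.
* A. Connes, *The Riemann Hypothesis: Past, Present and a Letter Through Time* (2026),
  arXiv:2602.04022, §6.4.
-/

noncomputable section

open Complex Filter Set MeasureTheory
open scoped Real Topology ENNReal ComplexConjugate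

namespace Literature.NumberTheory.LFunctions

/-! ## The definition -/

/-- **Ground state of the truncated Weil form, operator-free.** `IsWeilGroundState a u` says that
`u : ℝ → ℂ` is square integrable and is the `L²`-limit of an `L²`-normalised minimising sequence of
test functions on the window `[-a, a]`: there are smooth compactly supported `gₙ` with
`tsupport gₙ ⊆ [-a, a]`, `∫ |gₙ|² = 1`, `Re Q(gₙ) → ε(a) = weilGroundEnergy a` and `∫ |gₙ − u|² → 0`.
This is Bombieri's Problem 2 / Theorem 3 (minimise `T[f * f̄*]` on the unit sphere of `L²(E)`,
`E = [e^{-a}, e^{a}]`; a minimising sequence converges strongly in `L²` to a minimiser, which solves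
the eigenvalue equation (4.2) `λ f = L[f]`), and the normalised bottom eigenvector `ξ`, `‖ξ‖ = 1`,
of Connes–van Suijlekom Thm 6.1 / the eigenvector for the smallest eigenvalue `ε(λ)` of Connes'
`A_λ` (§6.4), approximated in `L²` by normalised form-core elements with form values `< λ + ε`.
Existence of a ground state (Bombieri Thm 3) is NOT part of the predicate.
[cite: Bombieri2000Weil, §4 Problem 2, Lemma 1 (4.2), Thm 3] -/
def IsWeilGroundState (a : ℝ) (u : ℝ → ℂ) : Prop :=
  MemLp u 2 ∧ ∃ g : ℕ → ℝ → ℂ,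
    (∀ n, IsWeilTest (g n) ∧ tsupport (g n) ⊆ Icc (-a) a ∧ ∫ t, ‖g n t‖ ^ 2 = (1 : ℝ)) ∧
    Tendsto (fun n ↦ (weilQuadratic (g n)).re) atTop (𝓝 (weilGroundEnergy a)) ∧
    Tendsto (fun n ↦ ∫ t, ‖g n t - u t‖ ^ 2) atTop (𝓝 0)

/-- Unfolding: `IsWeilGroundState a u` is literally the inline predicate `MemLp u 2 ∧ ∃ g, …` of
the route statements. [folklore] -/
theorem isWeilGroundState_iff (a : ℝ) (u : ℝ → ℂ) :
    IsWeilGroundState a u ↔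
      MemLp u 2 ∧ ∃ g : ℕ → ℝ → ℂ,
        (∀ n, IsWeilTest (g n) ∧ tsupport (g n) ⊆ Icc (-a) a ∧ ∫ t, ‖g n t‖ ^ 2 = (1 : ℝ)) ∧
        Tendsto (fun n ↦ (weilQuadratic (g n)).re) atTop (𝓝 (weilGroundEnergy a)) ∧
        Tendsto (fun n ↦ ∫ t, ‖g n t - u t‖ ^ 2) atTop (𝓝 0) :=
  Iff.rfl

/-! ## `L²` bookkeeping: `‖f‖₂ = √(∫ |f|²)` and Minkowski in square-root form -/

/-- For `f ∈ L²(ℝ)`, `eLpNorm f 2 = ofReal √(∫ |f|²)` (`MemLp.eLpNorm_eq_integral_rpow_norm` at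
`p = 2`). [folklore] -/
theorem eLpNorm_two_eq_ofReal_sqrt {f : ℝ → ℂ} (hf : MemLp f 2) :
    eLpNorm f 2 volume = ENNReal.ofReal (Real.sqrt (∫ t, ‖f t‖ ^ 2)) := by
  rw [hf.eLpNorm_eq_integral_rpow_norm two_ne_zero ENNReal.ofNat_ne_top]
  congr 1
  rw [Real.sqrt_eq_rpow, ENNReal.toReal_ofNat]
  simp_rw [Real.rpow_two]
  norm_num

/-- Minkowski's inequality in `L²(ℝ)`, square-root form: `√∫|f − h|² ≤ √∫|f|² + √∫|h|²`. [folklore] -/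
theorem sqrt_integral_norm_sq_sub_le {f h : ℝ → ℂ} (hf : MemLp f 2) (hh : MemLp h 2) :
    Real.sqrt (∫ t, ‖f t - h t‖ ^ 2) ≤
      Real.sqrt (∫ t, ‖f t‖ ^ 2) + Real.sqrt (∫ t, ‖h t‖ ^ 2) := by
  have key := eLpNorm_sub_le hf.aestronglyMeasurable hh.aestronglyMeasurable
    (one_le_two : (1 : ℝ≥0∞) ≤ 2) (μ := volume)
  rw [eLpNorm_two_eq_ofReal_sqrt (hf.sub hh), eLpNorm_two_eq_ofReal_sqrt hf,
    eLpNorm_two_eq_ofReal_sqrt hh, ← ENNReal.ofReal_add (Real.sqrt_nonneg _) (Real.sqrt_nonneg _),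
    ENNReal.ofReal_le_ofReal_iff (add_nonneg (Real.sqrt_nonneg _) (Real.sqrt_nonneg _))] at key
  simpa only [Pi.sub_apply] using key

/-! ## API of `IsWeilGroundState` -/

namespace IsWeilGroundState

variable {a : ℝ} {u v : ℝ → ℂ}

/-- A ground state is square integrable. [folklore] -/
theorem memLp (h : IsWeilGroundState a u) : MemLp u 2 :=
  h.1

/-- **Normalisation** `∫ |u|² = 1`: `|‖gₙ‖₂ − ‖u‖₂| ≤ ‖gₙ − u‖₂ → 0` and `‖gₙ‖₂ = 1` (Bombieri 2000,
proof of Thm 3: the strong `L²`-limit of the minimising sequence stays on the unit sphere). [cite: Bombieri2000Weil, §4 Thm 3 (proof)] -/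
theorem integral_norm_sq (h : IsWeilGroundState a u) : ∫ t, ‖u t‖ ^ 2 = 1 := by
  obtain ⟨hu, g, hg, -, hlim⟩ := h
  have hgm : ∀ n, MemLp (g n) 2 := fun n ↦
    (hg n).1.1.continuous.memLp_of_hasCompactSupport (hg n).1.2
  have hsqrt : Tendsto (fun n ↦ Real.sqrt (∫ t, ‖g n t - u t‖ ^ 2)) atTop (𝓝 0) := by
    simpa using hlim.sqrt
  set S : ℝ := Real.sqrt (∫ t, ‖u t‖ ^ 2) with hS
  -- `‖u‖₂ ≤ ‖gₙ‖₂ + ‖gₙ - u‖₂ = 1 + ‖gₙ - u‖₂` and `1 = ‖gₙ‖₂ ≤ ‖u‖₂ + ‖u - gₙ‖₂`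
  have h1 : ∀ n, S ≤ 1 + Real.sqrt (∫ t, ‖g n t - u t‖ ^ 2) := fun n ↦ by
    have := sqrt_integral_norm_sq_sub_le (hgm n) ((hgm n).sub hu)
    simpa only [Pi.sub_apply, sub_sub_cancel, (hg n).2.2, Real.sqrt_one] using this
  have h2 : ∀ n, 1 ≤ S + Real.sqrt (∫ t, ‖g n t - u t‖ ^ 2) := fun n ↦ by
    have := sqrt_integral_norm_sq_sub_le hu (hu.sub (hgm n))
    simpa only [Pi.sub_apply, sub_sub_cancel, (hg n).2.2, Real.sqrt_one, norm_sub_rev (u _)]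
      using this
  have hle : S ≤ 1 :=
    le_of_tendsto_of_tendsto' tendsto_const_nhds
      (by simpa using tendsto_const_nhds.add hsqrt) h1
  have hge : 1 ≤ S :=
    ge_of_tendsto' (by simpa using tendsto_const_nhds.add hsqrt) h2
  exact Real.sqrt_eq_one.1 (le_antisymm hle hge)

/-- `‖u‖_{L²} = 1` in `eLpNorm` form. [folklore] -/
theorem eLpNorm_eq_one (h : IsWeilGroundState a u) : eLpNorm u 2 volume = 1 := by
  rw [eLpNorm_two_eq_ofReal_sqrt h.memLp, h.integral_norm_sq, Real.sqrt_one, ENNReal.ofReal_one]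

/-- A ground state is not the zero function. [folklore] -/
theorem ne_zero (h : IsWeilGroundState a u) : u ≠ 0 := by
  intro hu
  have := h.integral_norm_sq
  simp [hu] at this

/-- **The window is non-degenerate**: `IsWeilGroundState a u → 0 < a`. For `a ≤ 0` the open set
`support g ⊆ interior [-a, a] = ∅`, so a test function on the window vanishes and cannot have
`∫ |g|² = 1`. [folklore] -/
theorem pos (h : IsWeilGroundState a u) : 0 < a := by
  obtain ⟨-, g, hg, -, -⟩ := h
  by_contra ha
  have ha' : a ≤ 0 := not_lt.1 ha
  have hsub : Function.support (g 0) ⊆ interior (Icc (-a) a) :=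
    interior_maximal ((subset_tsupport _).trans (hg 0).2.1)
      (hg 0).1.1.continuous.isOpen_support
  rw [interior_Icc, Set.Ioo_eq_empty_of_le (by linarith : a ≤ -a), subset_empty_iff,
    Function.support_eq_empty_iff] at hsub
  have h1 := (hg 0).2.2
  simp [hsub] at h1

/-- **Localisation**: a ground state vanishes a.e. off the window `[-a, a]`. Indeed `gₙ = 0` off
`[-a, a]`, so `∫_{[-a,a]ᶜ} |u|² = ∫_{[-a,a]ᶜ} |gₙ − u|² ≤ ∫ |gₙ − u|² → 0`. (Bombieri 2000 §4: the
minimiser lies in `L²(E)`, functions with support in `E`.) [cite: Bombieri2000Weil, §4 Problem 2 and Thm 3] -/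
theorem ae_eq_zero_of_notMem (h : IsWeilGroundState a u) :
    ∀ᵐ t : ℝ, t ∉ Icc (-a) a → u t = 0 := by
  obtain ⟨hu, g, hg, -, hlim⟩ := h
  have hgm : ∀ n, MemLp (g n) 2 := fun n ↦
    (hg n).1.1.continuous.memLp_of_hasCompactSupport (hg n).1.2
  set S : Set ℝ := (Icc (-a) a)ᶜ with hSdef
  have hS : MeasurableSet S := measurableSet_Icc.compl
  have hint : ∀ n, Integrable (fun t ↦ ‖g n t - u t‖ ^ 2) := fun n ↦ by
    have hm : MemLp (fun t ↦ g n t - u t) 2 := (hgm n).sub hu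
    exact (memLp_two_iff_integrable_sq_norm hm.1).1 hm
  have hu2 : Integrable (fun t ↦ ‖u t‖ ^ 2) := (memLp_two_iff_integrable_sq_norm hu.1).1 hu
  have hle : ∀ n, ∫ t in S, ‖u t‖ ^ 2 ≤ ∫ t, ‖g n t - u t‖ ^ 2 := fun n ↦
    calc ∫ t in S, ‖u t‖ ^ 2 = ∫ t in S, ‖g n t - u t‖ ^ 2 := by
          refine setIntegral_congr_fun hS fun t ht ↦ ?_
          have h0 : g n t = 0 :=
            image_eq_zero_of_notMem_tsupport fun h' ↦ ht ((hg n).2.1 h')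
          simp only [h0, zero_sub, norm_neg]
      _ ≤ ∫ t, ‖g n t - u t‖ ^ 2 :=
          setIntegral_le_integral (hint n) (Eventually.of_forall fun t ↦ by positivity)
  have hz : ∫ t in S, ‖u t‖ ^ 2 = 0 :=
    le_antisymm (ge_of_tendsto' hlim hle) (integral_nonneg fun t ↦ by positivity)
  have hae : (fun t ↦ ‖u t‖ ^ 2) =ᵐ[volume.restrict S] 0 :=
    (setIntegral_eq_zero_iff_of_nonneg_ae (Eventually.of_forall fun t ↦ by positivity)
      hu2.integrableOn).1 hz
  have hae' : ∀ᵐ t ∂(volume.restrict S), u t = 0 :=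
    hae.mono fun t ht ↦ by simpa using ht
  exact (ae_restrict_iff' hS).1 hae'

/-- A ground state agrees a.e. with its truncation to the window. [folklore] -/
theorem ae_eq_indicator (h : IsWeilGroundState a u) :
    u =ᵐ[volume] (Icc (-a) a).indicator u := by
  filter_upwards [h.ae_eq_zero_of_notMem] with t ht
  by_cases hm : t ∈ Icc (-a) a
  · simp [hm]
  · simp [hm, ht hm]

/-- A ground state is integrable on its window (`L² ⊆ L¹` on a set of finite measure). [folklore] -/
theorem integrableOn (h : IsWeilGroundState a u) : IntegrableOn u (Icc (-a) a) :=
  (h.memLp.restrict (Icc (-a) a)).integrable one_le_two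

/-- A ground state is integrable on `ℝ` (integrable on the window, a.e. zero off it). [folklore] -/
theorem integrable (h : IsWeilGroundState a u) : Integrable u :=
  h.integrableOn.integrable_of_ae_notMem_eq_zero h.ae_eq_zero_of_notMem

/-- `u · w` is integrable for every continuous `w` (`w` is bounded on the compact window and `u`
vanishes a.e. off it). [folklore] -/
theorem integrable_mul_continuous (h : IsWeilGroundState a u) {w : ℝ → ℂ} (hw : Continuous w) :
    Integrable fun t ↦ u t * w t :=
  (h.integrableOn.mul_continuousOn hw.continuousOn isCompact_Icc).integrable_of_ae_notMem_eq_zero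
    (h.ae_eq_zero_of_notMem.mono fun t ht hts ↦ by simp [ht hts])

/-- **Exponential moments**: `t ↦ u(t) e^{ct}` is integrable for every `c : ℂ` (in particular the
integrand of `weilMellin u s`, every `s`). [folklore] -/
theorem integrable_mul_cexp (h : IsWeilGroundState a u) (c : ℂ) :
    Integrable fun t : ℝ ↦ u t * cexp (c * t) :=
  h.integrable_mul_continuous (by fun_prop)

/-- **`û` is entire**, with `û'(s) = ∫ u(t) t e^{(s-1/2)t} dt`: differentiation under the integral
sign, dominated on the ball `‖s − s₀‖ < 1` by `|u(t)| |t| e^{(‖s₀‖+2)|t|}`, which is integrable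
because `u` is integrable on the window and vanishes a.e. off it (Bombieri 2000 §4, proof of
Thm 3: "the entire function `f̃_ν(s)`", Lemma 4). [cite: Bombieri2000Weil, §4 Lemma 4 and Thm 3 (proof)] -/
theorem hasDerivAt_weilMellin (h : IsWeilGroundState a u) (s₀ : ℂ) :
    HasDerivAt (weilMellin u) (∫ t : ℝ, u t * (t * cexp ((s₀ - 1 / 2) * t))) s₀ := by
  set A : ℝ := ‖s₀‖ + 2 with hA
  have hum : AEStronglyMeasurable u volume := h.memLp.1
  have hF_meas : ∀ᶠ s in 𝓝 s₀,
      AEStronglyMeasurable (fun t : ℝ ↦ u t * cexp ((s - 1 / 2) * t)) volume :=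
    Eventually.of_forall fun s ↦
      hum.mul (by fun_prop : Continuous fun t : ℝ ↦ cexp ((s - 1 / 2) * t)).aestronglyMeasurable
  have hF_int : Integrable (fun t : ℝ ↦ u t * cexp ((s₀ - 1 / 2) * t)) :=
    h.integrable_mul_continuous (by fun_prop)
  have hF'_meas :
      AEStronglyMeasurable (fun t : ℝ ↦ u t * (t * cexp ((s₀ - 1 / 2) * t))) volume :=
    hum.mul
      (by fun_prop : Continuous fun t : ℝ ↦ (t : ℂ) * cexp ((s₀ - 1 / 2) * t)).aestronglyMeasurable
  have h_bound : ∀ᵐ t : ℝ, ∀ s ∈ Metric.ball s₀ 1,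
      ‖u t * (t * cexp ((s - 1 / 2) * t))‖ ≤ ‖u t‖ * (|t| * Real.exp (A * |t|)) := by
    refine Eventually.of_forall fun t s hs ↦ ?_
    rw [norm_mul, norm_mul, Complex.norm_exp, Complex.norm_real, Real.norm_eq_abs]
    refine mul_le_mul_of_nonneg_left (mul_le_mul_of_nonneg_left (Real.exp_le_exp.2 ?_)
      (abs_nonneg _)) (norm_nonneg _)
    have hre : ((s - 1 / 2) * (t : ℂ)).re = (s.re - 1 / 2) * t := by simp [sub_re, mul_re]
    rw [hre]
    have hs' : ‖s - s₀‖ < 1 := by rwa [Metric.mem_ball, dist_eq_norm] at hs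
    have h3 : |s.re - 1 / 2| ≤ A := by
      have e : s.re - 1 / 2 = (s - s₀).re + s₀.re + (-(1 / 2)) := by simp; ring
      rw [e, hA]
      refine (abs_add_three _ _ _).trans ?_
      rw [abs_neg, abs_of_pos (by norm_num : (0 : ℝ) < 1 / 2)]
      linarith [abs_re_le_norm (s - s₀), abs_re_le_norm s₀]
    calc (s.re - 1 / 2) * t ≤ |(s.re - 1 / 2) * t| := le_abs_self _
      _ = |s.re - 1 / 2| * |t| := abs_mul _ _
      _ ≤ A * |t| := mul_le_mul_of_nonneg_right h3 (abs_nonneg _)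
  have bound_integrable : Integrable fun t : ℝ ↦ ‖u t‖ * (|t| * Real.exp (A * |t|)) :=
    (IntegrableOn.mul_continuousOn h.integrableOn.norm
      (by fun_prop : Continuous fun t : ℝ ↦ |t| * Real.exp (A * |t|)).continuousOn
      isCompact_Icc).integrable_of_ae_notMem_eq_zero
        (h.ae_eq_zero_of_notMem.mono fun t ht hts ↦ by simp [ht hts])
  have h_diff : ∀ᵐ t : ℝ, ∀ s ∈ Metric.ball s₀ 1,
      HasDerivAt (fun s : ℂ ↦ u t * cexp ((s - 1 / 2) * t))
        (u t * (t * cexp ((s - 1 / 2) * t))) s :=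
    Eventually.of_forall fun t s _ ↦ hasDerivAt_weilIntegrand u t s
  exact (hasDerivAt_integral_of_dominated_loc_of_deriv_le (Metric.ball_mem_nhds s₀ one_pos)
    hF_meas hF_int hF'_meas h_bound bound_integrable h_diff).2

/-- The Mellin–Laplace transform `û = weilMellin u` of a ground state is an entire function
(Connes–van Suijlekom 2025, Thm 6.1: "the entire function `ξ̂(z)`"; Bombieri 2000 §4). [cite: ConnesSuijlekom2025, Thm 6.1] -/
theorem differentiable_weilMellin (h : IsWeilGroundState a u) :
    Differentiable ℂ (weilMellin u) :=
  fun s ↦ (h.hasDerivAt_weilMellin s).differentiableAt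

/-- **Phase invariance**: if `u` is a ground state then so is `c u` for every constant `|c| = 1`
(minimising sequence `c gₙ`; `Q(c g) = |c|² Q(g)`, `weilQuadratic_const_mul`). [folklore] -/
theorem const_mul (h : IsWeilGroundState a u) {c : ℂ} (hc : ‖c‖ = 1) :
    IsWeilGroundState a (fun t ↦ c * u t) := by
  obtain ⟨hu, g, hg, hQ, hlim⟩ := h
  refine ⟨hu.const_mul c, fun n t ↦ c * g n t, fun n ↦ ⟨(hg n).1.const_mul c,
    tsupport_mul_subset_right.trans (hg n).2.1, ?_⟩, ?_, ?_⟩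
  · simpa only [norm_mul, mul_pow, hc, one_pow, one_mul] using (hg n).2.2
  · have hc2 : (Complex.normSq c : ℂ) = 1 := by
      rw [Complex.normSq_eq_norm_sq, hc]
      simp
    simpa only [weilQuadratic_const_mul, hc2, one_mul] using hQ
  · simpa only [← mul_sub, norm_mul, mul_pow, hc, one_pow, one_mul] using hlim

/-- Phase invariance, `•` form: `IsWeilGroundState a (c • u)` for `‖c‖ = 1`. [folklore] -/
theorem smul (h : IsWeilGroundState a u) {c : ℂ} (hc : ‖c‖ = 1) :
    IsWeilGroundState a (c • u) :=
  h.const_mul hc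

/-- **Invariance under modification on a null set**: the predicate only sees `u` through `MemLp`
and `∫ |gₙ − u|²`. [folklore] -/
theorem congr_ae (h : IsWeilGroundState a u) (huv : u =ᵐ[volume] v) : IsWeilGroundState a v := by
  obtain ⟨hu, g, hg, hQ, hlim⟩ := h
  refine ⟨hu.ae_eq huv, g, hg, hQ, ?_⟩
  have he : ∀ n, ∫ t, ‖g n t - v t‖ ^ 2 = ∫ t, ‖g n t - u t‖ ^ 2 := fun n ↦
    integral_congr_ae (huv.mono fun t ht ↦ by simp [ht])
  simpa only [he] using hlim

end IsWeilGroundState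

/-- `IsWeilGroundState a` is a property of the a.e.-class of `u`. [folklore] -/
theorem isWeilGroundState_congr_ae {a : ℝ} {u v : ℝ → ℂ} (huv : u =ᵐ[volume] v) :
    IsWeilGroundState a u ↔ IsWeilGroundState a v :=
  ⟨fun h ↦ h.congr_ae huv, fun h ↦ h.congr_ae huv.symm⟩

/-- The zero function is never a ground state. [folklore] -/
theorem not_isWeilGroundState_zero (a : ℝ) : ¬ IsWeilGroundState a 0 :=
  fun h ↦ h.ne_zero rfl

/-! ## Minimising sequences exist on every window `a > 0` -/

/-- **The unit sphere of a window is nonempty**: for `a > 0` there is a test function `g` with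
`tsupport g ⊆ [-a, a]` and `∫ |g|² = 1` (Mathlib's smooth bump of outer radius `a`, made complex
and normalised; cf. the normalisation step of `weilGroundEnergy_nonneg_iff_holds`). [folklore] -/
theorem exists_isWeilTest_sphere {a : ℝ} (ha : 0 < a) :
    ∃ g : ℝ → ℂ, IsWeilTest g ∧ tsupport g ⊆ Icc (-a) a ∧ ∫ t, ‖g t‖ ^ 2 = (1 : ℝ) := by
  let b : ContDiffBump (0 : ℝ) := ⟨a / 2, a, by positivity, by linarith⟩
  set g₁ : ℝ → ℂ := fun t ↦ ((b t : ℝ) : ℂ) with hg₁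
  have hg₁t : IsWeilTest g₁ :=
    ⟨Complex.ofRealCLM.contDiff.comp b.contDiff,
      b.hasCompactSupport.comp_left Complex.ofReal_zero⟩
  have hsupp₁ : tsupport g₁ ⊆ Icc (-a) a := by
    refine (tsupport_comp_subset Complex.ofReal_zero _).trans ?_
    rw [b.tsupport_eq, Real.closedBall_eq_Icc, zero_sub, zero_add]
  have hnn : 0 ≤ ∫ t, ‖g₁ t‖ ^ 2 := integral_nonneg fun _ ↦ by positivity
  have hN : 0 < ∫ t, ‖g₁ t‖ ^ 2 := by
    rcases hnn.eq_or_lt with hz | hpos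
    · exfalso
      have h0 : g₁ = 0 := hg₁t.eq_zero_of_integral_norm_sq_eq_zero hz.symm
      have h1 : g₁ 0 = 1 := by
        have hb : b 0 = 1 :=
          b.one_of_mem_closedBall (Metric.mem_closedBall_self (by positivity))
        simp [hg₁, hb]
      rw [h0] at h1
      simp at h1
    · exact hpos
  set N : ℝ := ∫ t, ‖g₁ t‖ ^ 2 with hN'
  set c : ℝ := (Real.sqrt N)⁻¹ with hc
  have hcpos : 0 < c := inv_pos.2 (Real.sqrt_pos.2 hN)
  refine ⟨fun t ↦ (c : ℂ) * g₁ t, hg₁t.const_mul c, tsupport_mul_subset_right.trans hsupp₁, ?_⟩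
  simp only [norm_mul, mul_pow, Complex.norm_real, Real.norm_of_nonneg hcpos.le]
  rw [integral_const_mul, hc, inv_pow, Real.sq_sqrt hnn, inv_mul_cancel₀ hN.ne']

/-- **Minimising sequences exist**: for every window `a > 0` there is an `L²`-normalised sequence
of test functions `gₙ` on `[-a, a]` with `Re Q(gₙ) → ε(a)` (the unit sphere of the window is
nonempty, `exists_isWeilTest_sphere`, and `Re Q` is bounded below on it,
`bddBelow_weilQuadratic_sphere_holds`; then `exists_seq_tendsto_sInf`). So `IsWeilGroundState a u`
asks exactly for the `L²`-CONVERGENCE of such a sequence to `u`; that some minimising sequence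
converges is Bombieri's Theorem 3, not proved here. [cite: Bombieri2000Weil, §4 Thm 3 (proof, first paragraph)] -/
theorem exists_weilMinimizingSeq {a : ℝ} (ha : 0 < a) :
    ∃ g : ℕ → ℝ → ℂ,
      (∀ n, IsWeilTest (g n) ∧ tsupport (g n) ⊆ Icc (-a) a ∧ ∫ t, ‖g n t‖ ^ 2 = (1 : ℝ)) ∧
      Tendsto (fun n ↦ (weilQuadratic (g n)).re) atTop (𝓝 (weilGroundEnergy a)) := by
  set S : Set ℝ := {x : ℝ | ∃ g : ℝ → ℂ, IsWeilTest g ∧ tsupport g ⊆ Icc (-a) a ∧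
    ∫ t : ℝ, ‖g t‖ ^ 2 = 1 ∧ x = (weilQuadratic g).re} with hSdef
  have hne : S.Nonempty := by
    obtain ⟨g, hg, hsupp, hnorm⟩ := exists_isWeilTest_sphere ha
    exact ⟨_, g, hg, hsupp, hnorm, rfl⟩
  have hbdd : BddBelow S := bddBelow_weilQuadratic_sphere_holds a
  obtain ⟨x, -, hx, hmem⟩ := exists_seq_tendsto_sInf hne hbdd
  have hmem' : ∀ n, ∃ g : ℝ → ℂ, IsWeilTest g ∧ tsupport g ⊆ Icc (-a) a ∧
      ∫ t : ℝ, ‖g t‖ ^ 2 = 1 ∧ x n = (weilQuadratic g).re := hmem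
  choose g hg hsupp hnorm hxg using hmem'
  refine ⟨g, fun n ↦ ⟨hg n, hsupp n, hnorm n⟩, ?_⟩
  have hfun : (fun n ↦ (weilQuadratic (g n)).re) = x := funext fun n ↦ (hxg n).symm
  rw [hfun]
  exact hx

end Literature.NumberTheory.LFunctions

end
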